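import Literature.AlgebraicGeometry.Resolution.BlowupStalkCharts
import Literature.AlgebraicGeometry.Resolution.AffineBlowupAlgebra
import Literature.AlgebraicGeometry.Resolution.ColonIdealSheafFG
import Literature.AlgebraicGeometry.Resolution.StalkIdealLemmas
import Literature.AlgebraicGeometry.Resolution.DerivativeIdealsChart
import HarnessLib

/-!
# The local rings of a blowing up are localizations of the affine blowup ALGEBRAS `𝒪_{X,s}[J_s/c_j]`

Topic: `Literature/AlgebraicGeometry/Resolution`. For a blowing up `π : X' → X` in the sense of the universal property
(`IsBlowup π J`, `Blowups.lean`; Görtz–Wedhorn I, Def. 13.90) of an ARBITRARY scheme along an arbitrary quasi-coherent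
ideal sheaf, and a point `x' ∈ X'` over `s = π x'`, the tree's dictionary `IsBlowup.exists_reesChart_stalk`
(`BlowupStalkCharts.lean`, Stacks 0804) presents `𝒪_{X',x'}` as a localization of the Rees-model chart ring
`chartRing c j = (𝒪_{X,s}[J_s t])_{(c_j t)}`. This file moves that presentation across the chart isomorphism
`reesChartEquiv : chartRing c j ≃+* 𝒪_{X,s}[J_s/c_j]` (Stacks 07Z3, `AffineBlowupAlgebra.lean`; the subalgebra model
`blowupAlgebra I a = R[I/a] ⊆ R[1/a]`, Görtz–Wedhorn (13.19)) and packages it as an explicit ring isomorphism, so that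
ring-level statements about primes of the affine blowup algebras are read at the points of any blow-up:

* `blowupAlgebra_stalk_ringEquiv_of_reesChart` — TRANSPORT at a GIVEN chart index `i`: a Rees-chart presentation
  `(𝔴, χ₀)` of `𝒪_{X',x'}` on `chartRing c i` becomes one on `𝒪_{X,s}[J_s/c_i]`, compatible with `χ₀` along `reesChartEquiv`
  (so a chart chosen for other reasons — e.g. meeting a strict transform — is kept), with the `IsLocalization.AtPrime`
  structure, an explicit `𝒪_{X',x'} ≅ (𝒪_{X,s}[J_s/c_i])_𝔔`, `𝔔 ∩ 𝒪_{X,s} = 𝔪_s` and `b ∈ 𝔔 ↔ ε⁻¹ b ∈ 𝔴`;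
* `IsBlowup.exists_blowupAlgebra_stalk_ringEquiv` — for `x' ∈ X'` and generators `c₁, …, c_k` of `J_s`: some `j`, a prime
  `𝔔` of `𝒪_{X,s}[J_s/c_j]` lying over `𝔪_s`, a ring map `χ : 𝒪_{X,s}[J_s/c_j] → 𝒪_{X',x'}` extending `π^♯_{x'}`, and a
  ring isomorphism `𝒪_{X',x'} ≅ (𝒪_{X,s}[J_s/c_j])_𝔔` sending `χ b ↦ b/1`;
* `IsBlowup.exists_blowupAlgebra_stalk_ringEquiv_of_eq` — the same for any ideal `I = (c₁, …, c_k)` of `𝒪_{X,s}` equal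
  to `J_s`;
* `IsBlowup.exists_isRegularLocalRing_stalk_iff_blowupAlgebra` — hence `𝒪_{X',x'}` is regular iff `(𝒪_{X,s}[J_s/c_j])_𝔔`
  is, with the membership dictionary `a ∈ 𝔪_s ↔ a/1 ∈ 𝔔`;
* `IsBlowup.stalkIdeal_controlledTransform_eq_map_of_chart` — in such a presentation (any `χ` over `π^♯_{x'}` with
  `π^♯(c_i)` a non-zero-divisor): the exceptional ideal `𝓘(E)_{x'} = (π^♯ c_i)` and, for `K_s ⊆ J_s^a`, the controlled
  transform `σᶜ(K, a)_{x'} = χ(K″)·𝒪_{X',x'}`, `K″ = (u : u·(c_i/1)^a = k/1, k ∈ K_s)` the ideal of quotients `k/c_i^a`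
  (BGMW §3.2; GW (13.19)); `IsBlowup.stalkIdeal_controlledTransform_eq_top_of_chart_mem` — the `c_i`-chart misses
  `V(σᶜ(K, 1))` when `c_i ∈ K_s`; `IsBlowup.stalkIdeal_controlledTransform_eq_map_of_isLocalization` — the same dictionary with the
  non-zero-divisor hypothesis discharged from a localisation presentation.

Literature-side twin of the campaign helper `Summits/ResolutionOfSingularities/…/Theorems/EquisingularLiftCampaignW45bBlowupStalkDictionary.lean`
(cell `res-hironaka`, W4.5b; same statements and proofs, adapted), placed here so that Literature files — the assembly of
[24] Thm 10.5's IF half (Cor 10.4's induction along the charts of Lemma 10.3, `Hironaka2005AmbientReductionIfSpine*`) —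
can use it. Everything is PROVED; no definitions, no named facts.

## Sources
* The Stacks Project, Tag 0804 (the charts `Spec A[I/a]` of a blowing up), Tag 07Z3 (`(R[It])_{(at)} ≅ R[I/a]`).
  [StacksProject]
* U. Görtz, T. Wedhorn, *Algebraic Geometry I*, 2nd ed. (2020), Def. 13.90, (13.19) p. 415. [GortzWedhorn2020]
-/

noncomputable section

open CategoryTheory AlgebraicGeometry TopologicalSpace IsLocalRing

namespace Literature.AlgebraicGeometry.Resolution

universe u

variable {X' X : Scheme.{u}} {π : X' ⟶ X} {J : X.IdealSheafData}

set_option maxHeartbeats 800000 in -- instance unification on the Rees chart ring `chartRing c i` is slow (as in `BlowupDimension.lean` and the Summits twin)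
/-- **Transport of a Rees-chart presentation of `𝒪_{X',x'}` to the affine blowup algebra.** For a blowing up `π` along `J`,
`x' ∈ X'`, generators `c` of `J_s` (`s = π x'`), and a chart presentation AT A GIVEN INDEX `i` — a prime `𝔴` of
`B_i = chartRing c i` with a ring map `χ₀ : B_i → 𝒪_{X',x'}` over `π^♯_{x'}` exhibiting `𝒪_{X',x'}` as `(B_i)_𝔴` and
`𝔴 ∩ 𝒪_{X,s} = 𝔪_s` (the output of `IsBlowup.exists_reesChart_stalk`, or any other such choice): along
`ε = reesChartEquiv : B_i ≃+* R[I/c_i]` (`R = 𝒪_{X,s}`, `I = (c)`; Stacks 07Z3) one gets the prime `𝔔 = ε(𝔴)` of `R[I/c_i]`, the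
ring map `χ = χ₀ ∘ ε⁻¹ : R[I/c_i] → 𝒪_{X',x'}` — again over `π^♯_{x'}` and COMPATIBLE with `χ₀` (`χ (ε b₀) = χ₀ b₀`) —
exhibiting `𝒪_{X',x'}` as the localization `R[I/c_i]_𝔔` (the `IsLocalization.AtPrime` structure along `χ`, and an explicit ring
isomorphism `e : 𝒪_{X',x'} ≅ R[I/c_i]_𝔔` with `e (χ b) = b/1`), with `𝔔 ∩ R = 𝔪_s` and `b ∈ 𝔔 ↔ ε⁻¹ b ∈ 𝔴`. The index `i` is
an INPUT, so a chart already chosen for other reasons (e.g. one meeting a strict transform) is kept.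
[cite: StacksProject, Tag 0804; StacksProject, Tag 07Z3] -/
theorem blowupAlgebra_stalk_ringEquiv_of_reesChart (x' : X') {k : ℕ}
    (c : Fin k → X.presheaf.stalk (π x')) (i : Fin k) (𝔴 : PrimeSpectrum (chartRing c i))
    (χ₀ : chartRing c i →+* X'.presheaf.stalk x') (h1 : ∀ a, χ₀ (chartBase c i a) = (π.stalkMap x').hom a)
    (hloc : @IsLocalization.AtPrime _ _ (X'.presheaf.stalk x') _ χ₀.toAlgebra 𝔴.asIdeal _)
    (h𝔴 : 𝔴.asIdeal.comap (chartBase c i) = maximalIdeal (X.presheaf.stalk (π x'))) :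
    ∃ (𝔔 : PrimeSpectrum (blowupAlgebra (Ideal.span (Set.range c)) (c i)))
      (χ : blowupAlgebra (Ideal.span (Set.range c)) (c i) →+* X'.presheaf.stalk x')
      (e : X'.presheaf.stalk x' ≃+* Localization.AtPrime 𝔔.asIdeal),
      (∀ a, χ (algebraMap _ _ a) = (π.stalkMap x').hom a) ∧
      (∀ b₀, χ (reesChartEquiv (I := Ideal.span (Set.range c)) (c i)
        (Ideal.mem_span_range_self (f := c) (x := i)) b₀) = χ₀ b₀) ∧
      @IsLocalization.AtPrime _ _ (X'.presheaf.stalk x') _ χ.toAlgebra 𝔔.asIdeal _ ∧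
      (∀ b, e (χ b) = algebraMap _ (Localization.AtPrime 𝔔.asIdeal) b) ∧
      𝔔.asIdeal.comap (algebraMap _ (blowupAlgebra (Ideal.span (Set.range c)) (c i))) =
        maximalIdeal (X.presheaf.stalk (π x')) ∧
      (∀ b, b ∈ 𝔔.asIdeal ↔ (reesChartEquiv (I := Ideal.span (Set.range c)) (c i)
        (Ideal.mem_span_range_self (f := c) (x := i))).symm b ∈ 𝔴.asIdeal) := by
  -- the chart isomorphism `ε : B_i ≃ R[I/c_i]`, the prime `𝔔 = ε(𝔴)` and `χ = χ₀ ∘ ε⁻¹`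
  set ε : chartRing c i ≃+* blowupAlgebra (Ideal.span (Set.range c)) (c i) :=
    reesChartEquiv (I := Ideal.span (Set.range c)) (c i) (Ideal.mem_span_range_self (f := c) (x := i)) with hεdef
  have hε : ∀ a, ε (chartBase c i a) = algebraMap _ (blowupAlgebra (Ideal.span (Set.range c)) (c i)) a :=
    reesChartEquiv_reesChartBase (c i) _
  obtain ⟨𝔔, hmem𝔔⟩ : ∃ 𝔔 : PrimeSpectrum (blowupAlgebra (Ideal.span (Set.range c)) (c i)),
      ∀ b, b ∈ 𝔔.asIdeal ↔ ε.symm b ∈ 𝔴.asIdeal :=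
    ⟨⟨Ideal.comap ε.symm.toRingHom 𝔴.asIdeal, Ideal.comap_isPrime ε.symm.toRingHom 𝔴.asIdeal⟩,
      fun b => Ideal.mem_comap⟩
  have hεbase : ∀ a, ε.symm (algebraMap _ (blowupAlgebra (Ideal.span (Set.range c)) (c i)) a) = chartBase c i a := by
    intro a
    rw [← hε, RingEquiv.symm_apply_apply]
  obtain ⟨χ, hχ⟩ : ∃ χ : blowupAlgebra (Ideal.span (Set.range c)) (c i) →+* X'.presheaf.stalk x',
      ∀ b, χ b = χ₀ (ε.symm b) := ⟨χ₀.comp ε.symm.toRingHom, fun b => rfl⟩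
  -- the three localization axioms, transported elementwise along the bijection `ε`
  have hU : ∀ y : 𝔴.asIdeal.primeCompl, IsUnit (χ₀ y) := fun y =>
    @IsLocalization.map_units _ _ 𝔴.asIdeal.primeCompl _ _ χ₀.toAlgebra hloc y
  have hS : ∀ z : X'.presheaf.stalk x', ∃ x : chartRing c i × 𝔴.asIdeal.primeCompl, z * χ₀ x.2 = χ₀ x.1 := fun z =>
    @IsLocalization.surj _ _ 𝔴.asIdeal.primeCompl _ _ χ₀.toAlgebra hloc z
  have hE : ∀ {x y : chartRing c i}, χ₀ x = χ₀ y → ∃ d : 𝔴.asIdeal.primeCompl, (d : chartRing c i) * x = d * y :=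
    fun {x y} h => @IsLocalization.exists_of_eq _ _ 𝔴.asIdeal.primeCompl _ _ χ₀.toAlgebra hloc x y h
  have hmemε : ∀ b₀ : chartRing c i, ε b₀ ∈ 𝔔.asIdeal ↔ b₀ ∈ 𝔴.asIdeal := fun b₀ => by
    rw [hmem𝔔, RingEquiv.symm_apply_apply]
  have hLM : 𝔔.asIdeal.primeCompl.IsLocalizationMap (χ : _ → X'.presheaf.stalk x') :=
    { map_units := fun y => by
        have hy' : ε.symm (y : blowupAlgebra (Ideal.span (Set.range c)) (c i)) ∈ 𝔴.asIdeal.primeCompl :=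
          fun h => y.2 ((hmem𝔔 _).mpr h)
        have hu := hU ⟨_, hy'⟩
        rwa [← hχ] at hu
      surj := fun z => by
        obtain ⟨⟨x₀, ⟨y₀, hy₀⟩⟩, hz⟩ := hS z
        have hy : ε y₀ ∈ 𝔔.asIdeal.primeCompl := fun h => hy₀ ((hmemε y₀).mp h)
        refine ⟨⟨ε x₀, ⟨ε y₀, hy⟩⟩, ?_⟩
        have e1 : χ (ε y₀) = χ₀ y₀ := by rw [hχ, RingEquiv.symm_apply_apply]
        have e2 : χ (ε x₀) = χ₀ x₀ := by rw [hχ, RingEquiv.symm_apply_apply]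
        simpa only [e1, e2] using hz
      exists_of_eq := fun {x y} hxy => by
        rw [hχ, hχ] at hxy
        obtain ⟨⟨d₀, hd₀⟩, hd⟩ := hE hxy
        have hd' : ε d₀ ∈ 𝔔.asIdeal.primeCompl := fun h => hd₀ ((hmemε d₀).mp h)
        refine ⟨⟨ε d₀, hd'⟩, ε.symm.injective ?_⟩
        simpa only [map_mul, RingEquiv.symm_apply_apply] using hd }
  have hloc' : @IsLocalization.AtPrime _ _ (X'.presheaf.stalk x') _ χ.toAlgebra 𝔔.asIdeal _ := by
    letI := χ.toAlgebra
    exact (isLocalization_iff_isLocalizationMap _ _).mpr hLM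
  -- `𝒪_{X',x'} ≅ R[I/c_i]_𝔔`: both are localizations of `R[I/c_i]` at `𝔔`
  letI := χ.toAlgebra
  haveI : IsLocalization.AtPrime (X'.presheaf.stalk x') 𝔔.asIdeal := hloc'
  let e : X'.presheaf.stalk x' ≃ₐ[blowupAlgebra (Ideal.span (Set.range c)) (c i)] Localization.AtPrime 𝔔.asIdeal :=
    IsLocalization.algEquiv 𝔔.asIdeal.primeCompl _ _
  refine ⟨𝔔, χ, e.toRingEquiv, fun a => ?_, fun b₀ => ?_, hloc', fun b => e.commutes b, ?_, hmem𝔔⟩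
  · rw [hχ, hεbase]
    exact h1 a
  · rw [hχ, RingEquiv.symm_apply_apply]
  · rw [← h𝔴]
    ext a
    rw [Ideal.mem_comap, Ideal.mem_comap, hmem𝔔, hεbase]

set_option maxHeartbeats 800000 in -- as above
/-- **The local rings of a blowing up are localizations of the affine blowup algebras `𝒪_{X,s}[J_s/c_j]`.** For a blowing up
`π : X' → X` along `J` (`IsBlowup`), `x' ∈ X'`, `s = π x'`, and generators `c₁, …, c_k` of the stalk `J_s`: for some `j` there are
a prime `𝔔` of `R[I/c_j]` (`R = 𝒪_{X,s}`, `I = J_s = (c)`) over `𝔪_s`, a ring map `χ : R[I/c_j] → 𝒪_{X',x'}` with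
`χ ∘ (R → R[I/c_j]) = π^♯_{x'}` exhibiting `𝒪_{X',x'}` as the localization `R[I/c_j]_𝔔`, and a ring isomorphism
`𝒪_{X',x'} ≅ R[I/c_j]_𝔔` with `χ b ↦ b/1` — `IsBlowup.exists_reesChart_stalk` transported along `reesChartEquiv`.
[cite: StacksProject, Tag 0804] -/
theorem IsBlowup.exists_blowupAlgebra_stalk_ringEquiv (hπ : IsBlowup π J) (x' : X') {k : ℕ}
    (c : Fin k → X.presheaf.stalk (π x')) (hc : Ideal.span (Set.range c) = stalkIdeal J (π x')) :
    ∃ (j : Fin k) (𝔔 : PrimeSpectrum (blowupAlgebra (Ideal.span (Set.range c)) (c j)))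
      (χ : blowupAlgebra (Ideal.span (Set.range c)) (c j) →+* X'.presheaf.stalk x')
      (e : X'.presheaf.stalk x' ≃+* Localization.AtPrime 𝔔.asIdeal),
      (∀ a, χ (algebraMap _ _ a) = (π.stalkMap x').hom a) ∧
      @IsLocalization.AtPrime _ _ (X'.presheaf.stalk x') _ χ.toAlgebra 𝔔.asIdeal _ ∧
      (∀ b, e (χ b) = algebraMap _ (Localization.AtPrime 𝔔.asIdeal) b) ∧
      𝔔.asIdeal.comap (algebraMap _ (blowupAlgebra (Ideal.span (Set.range c)) (c j))) =
        maximalIdeal (X.presheaf.stalk (π x')) := by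
  obtain ⟨j, 𝔴, χ₀, h1, hloc, h𝔴⟩ := hπ.exists_reesChart_stalk x' c hc
  obtain ⟨𝔔, χ, e, hχ, -, hloc', he, h𝔔, -⟩ := blowupAlgebra_stalk_ringEquiv_of_reesChart x' c j 𝔴 χ₀ h1 hloc h𝔴
  exact ⟨j, 𝔔, χ, e, hχ, hloc', he, h𝔔⟩

/-- The same presentation for any ideal `I` of `𝒪_{X,s}` written as `(c₁, …, c_k)` — e.g. `I = (e, w)` with `c = ![e, w]` —
so that the chart algebra is literally `blowupAlgebra I (c j)`. [cite: StacksProject, Tag 0804] -/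
theorem IsBlowup.exists_blowupAlgebra_stalk_ringEquiv_of_eq (hπ : IsBlowup π J) (x' : X') {k : ℕ}
    (c : Fin k → X.presheaf.stalk (π x')) (I : Ideal (X.presheaf.stalk (π x')))
    (hI : I = Ideal.span (Set.range c)) (hc : I = stalkIdeal J (π x')) :
    ∃ (j : Fin k) (𝔔 : PrimeSpectrum (blowupAlgebra I (c j))) (χ : blowupAlgebra I (c j) →+* X'.presheaf.stalk x')
      (e : X'.presheaf.stalk x' ≃+* Localization.AtPrime 𝔔.asIdeal),
      (∀ a, χ (algebraMap _ _ a) = (π.stalkMap x').hom a) ∧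
      @IsLocalization.AtPrime _ _ (X'.presheaf.stalk x') _ χ.toAlgebra 𝔔.asIdeal _ ∧
      (∀ b, e (χ b) = algebraMap _ (Localization.AtPrime 𝔔.asIdeal) b) ∧
      𝔔.asIdeal.comap (algebraMap _ (blowupAlgebra I (c j))) = maximalIdeal (X.presheaf.stalk (π x')) := by
  subst hI
  exact hπ.exists_blowupAlgebra_stalk_ringEquiv x' c hc

/-- **Regularity of the points of a blow-up is read on the affine blowup algebras**: in the situation of
`exists_blowupAlgebra_stalk_ringEquiv_of_eq`, `𝒪_{X',x'}` is a regular local ring iff the localization `R[I/c_j]_𝔔` is, and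
`a ∈ 𝔪_s ↔ a/1 ∈ 𝔔`. [cite: StacksProject, Tag 0804] -/
theorem IsBlowup.exists_isRegularLocalRing_stalk_iff_blowupAlgebra (hπ : IsBlowup π J) (x' : X') {k : ℕ}
    (c : Fin k → X.presheaf.stalk (π x')) (I : Ideal (X.presheaf.stalk (π x')))
    (hI : I = Ideal.span (Set.range c)) (hc : I = stalkIdeal J (π x')) :
    ∃ (j : Fin k) (𝔔 : PrimeSpectrum (blowupAlgebra I (c j))),
      (∀ a, a ∈ maximalIdeal (X.presheaf.stalk (π x')) ↔ algebraMap _ (blowupAlgebra I (c j)) a ∈ 𝔔.asIdeal) ∧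
      (IsRegularLocalRing (X'.presheaf.stalk x') ↔ IsRegularLocalRing (Localization.AtPrime 𝔔.asIdeal)) := by
  obtain ⟨j, 𝔔, χ, e, -, -, -, h𝔔⟩ := hπ.exists_blowupAlgebra_stalk_ringEquiv_of_eq x' c I hI hc
  refine ⟨j, 𝔔, fun a => by rw [← h𝔔, Ideal.mem_comap], ?_⟩
  exact ⟨fun h => @IsRegularLocalRing.of_ringEquiv _ _ h _ _ e, fun h => @IsRegularLocalRing.of_ringEquiv _ _ h _ _ e.symm⟩

/-! ## The exceptional ideal and the controlled transforms in the affine-blowup-algebra presentation -/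

section ControlledTransform

variable {D : X.IdealSheafData}

set_option maxHeartbeats 800000 in -- as above: instance unification on the affine blowup algebra of a stalk is slow
/-- **Stalks of the exceptional ideal and of controlled transforms, read on `𝒪_{X,s}[D_s/c_i]`.** For a blowing up `π`
along `D`, `x' ∈ X'` over `s`, generators `c` of `I = D_s`, and a ring map `χ : 𝒪_{X,s}[I/c_i] → 𝒪_{X',x'}` over `π^♯_{x'}`
(e.g. from `blowupAlgebra_stalk_ringEquiv_of_reesChart`) such that `g = π^♯(c_i)` is a non-zero-divisor of `𝒪_{X',x'}` (true
for any localization presentation, `c_i/1` being a non-zero-divisor of `𝒪_{X,s}[I/c_i]`, Stacks 07Z3 (1)): (1) `𝓘(E)_{x'} = (g)` —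
the exceptional ideal is generated by `c_i` on the chart (`I·R[I/a] = (a)`, Stacks 07Z3 (2)); (2) for every ideal sheaf `K`
with `K_s ⊆ I^a`, the controlled transform `σᶜ(K, a) = (π^*K : 𝓘(E)^a)` (BGMW §3.2) has
`σᶜ(K,a)_{x'} = χ(K″)·𝒪_{X',x'}` with `K″ = (u : u·(c_i/1)^a = k/1 for some k ∈ K_s) ⊆ 𝒪_{X,s}[I/c_i]` — the ideal of
the quotients `k/c_i^a` (GW (13.19); for `a = 1` and `K` the ideal of a regular subscheme through the centre this is the
strict transform on the chart, GW 13.96 (2)); in particular `σᶜ(K,a)_{x'} = 𝒪` as soon as `c_i ∈ K_s` and `a = 1`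
(`u = 1`). [cite: StacksProject, Tag 0804; StacksProject, Tag 07Z3; GortzWedhorn2020, (13.19) p. 415; BierstoneGrigorievMilmanWlodarczyk2011, §3.2 Lemma 3.2.1] -/
theorem IsBlowup.stalkIdeal_controlledTransform_eq_map_of_chart (hπ : IsBlowup π D) (x' : X') {k : ℕ}
    (c : Fin k → X.presheaf.stalk (π x')) (hc : Ideal.span (Set.range c) = stalkIdeal D (π x')) (i : Fin k)
    (χ : blowupAlgebra (Ideal.span (Set.range c)) (c i) →+* X'.presheaf.stalk x')
    (hχ : ∀ a, χ (algebraMap _ _ a) = (π.stalkMap x').hom a)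
    (hg : (π.stalkMap x').hom (c i) ∈ nonZeroDivisors (X'.presheaf.stalk x')) :
    stalkIdeal (D.comap π) x' = Ideal.span {(π.stalkMap x').hom (c i)} ∧
      ∀ (K : X.IdealSheafData) (a : ℕ), stalkIdeal K (π x') ≤ Ideal.span (Set.range c) ^ a →
        stalkIdeal (controlledTransform π D K a) x' =
          (Ideal.span {u : blowupAlgebra (Ideal.span (Set.range c)) (c i) |
              ∃ g ∈ stalkIdeal K (π x'),
                u * algebraMap _ (blowupAlgebra (Ideal.span (Set.range c)) (c i)) (c i) ^ a =
                  algebraMap _ (blowupAlgebra (Ideal.span (Set.range c)) (c i)) g}).map χ := by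
  -- notation: `z = c_i/1 ∈ B = 𝒪_{X,s}[I/c_i]`, `g = π^♯(c_i) = χ z ∈ 𝒪_{X',x'}`
  set z : blowupAlgebra (Ideal.span (Set.range c)) (c i) := algebraMap _ _ (c i) with hz
  set g : X'.presheaf.stalk x' := (π.stalkMap x').hom (c i) with hgdef
  have hgz : χ z = g := hχ (c i)
  -- `I·B = (z)`: `f ∈ I^a ⇒ f/1 = u·z^a`
  have hIB : (Ideal.span (Set.range c)).map (algebraMap _ (blowupAlgebra (Ideal.span (Set.range c)) (c i))) =
      Ideal.span {z} :=
    map_blowupAlgebra_eq_span (Ideal.mem_span_range_self (f := c) (x := i))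
  have hdiv : ∀ (a : ℕ) (f : X.presheaf.stalk (π x')), f ∈ Ideal.span (Set.range c) ^ a →
      ∃ u : blowupAlgebra (Ideal.span (Set.range c)) (c i), u * z ^ a = algebraMap _ _ f := by
    intro a f hf
    have h1 : algebraMap _ (blowupAlgebra (Ideal.span (Set.range c)) (c i)) f ∈ Ideal.span {z ^ a} := by
      rw [← Ideal.span_singleton_pow, ← hIB, ← Ideal.map_pow]
      exact Ideal.mem_map_of_mem _ hf
    exact Ideal.mem_span_singleton'.mp h1
  -- (1) the exceptional ideal: `𝓘(E)_{x'} = π^♯(I)·𝒪 = (g)`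
  have hE : stalkIdeal (D.comap π) x' = Ideal.span {g} := by
    rw [stalkIdeal_comap_eq_map_stalkMap, ← hc]
    apply le_antisymm
    · rw [Ideal.map_le_iff_le_comap, Ideal.span_le]
      rintro _ ⟨i', rfl⟩
      rw [SetLike.mem_coe, Ideal.mem_comap]
      obtain ⟨u, hu⟩ := hdiv 1 (c i') (by rw [pow_one]; exact Ideal.subset_span ⟨i', rfl⟩)
      rw [pow_one] at hu
      have h3 : (π.stalkMap x').hom (c i') = χ u * g := by
        rw [← hχ, ← hu, map_mul, hgz]
      rw [h3]
      exact Ideal.mul_mem_left _ _ (Ideal.mem_span_singleton_self g)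
    · rw [Ideal.span_singleton_le_iff_mem]
      exact Ideal.mem_map_of_mem _ (Ideal.subset_span ⟨i, rfl⟩)
  refine ⟨hE, fun K a hK => ?_⟩
  -- (2) `π^♯(K_s)·𝒪 = g^a · χ(K″)`, then cancel `g^a` in the colon
  set K2 : Ideal (blowupAlgebra (Ideal.span (Set.range c)) (c i)) :=
    Ideal.span {u : blowupAlgebra (Ideal.span (Set.range c)) (c i) |
      ∃ g' ∈ stalkIdeal K (π x'), u * z ^ a = algebraMap _ _ g'} with hK2
  have hKO : (stalkIdeal K (π x')).map (π.stalkMap x').hom = Ideal.span {g ^ a} * K2.map χ := by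
    apply le_antisymm
    · rw [Ideal.map_le_iff_le_comap]
      intro f hf
      obtain ⟨u, hu⟩ := hdiv a f (hK hf)
      rw [Ideal.mem_comap, Ideal.mem_span_singleton_mul]
      refine ⟨χ u, Ideal.mem_map_of_mem _ (Ideal.subset_span ⟨f, hf, hu⟩), ?_⟩
      rw [← hχ, ← hu, map_mul, map_pow, hgz, mul_comm]
    · have h2 : K2.map χ ≤ ((stalkIdeal K (π x')).map (π.stalkMap x').hom).colon (Ideal.span {g ^ a}) := by
        rw [Ideal.map_le_iff_le_comap, hK2, Ideal.span_le]
        rintro u ⟨f, hf, hu⟩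
        rw [SetLike.mem_coe, Ideal.mem_comap, Ideal.mem_colon_span_singleton, ← hgz, ← map_pow, ← map_mul, hu, hχ]
        exact Ideal.mem_map_of_mem _ hf
      rw [Ideal.span_singleton_mul_le_iff]
      intro w hw
      have h3 := h2 hw
      rw [Ideal.mem_colon_span_singleton] at h3
      rwa [mul_comm] at h3
  have hga : g ^ a ∈ nonZeroDivisors (X'.presheaf.stalk x') := pow_mem hg a
  rw [hπ.stalkIdeal_controlledTransform K a x', stalkIdeal_comap_eq_map_stalkMap π K x', hE,
    Ideal.span_singleton_pow, hKO, Ideal.colon_span, colon_span_singleton_mul_eq hga]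

/-- **Points of the blow-up missed by the `c_i`-chart of a transform**: in the situation of
`IsBlowup.stalkIdeal_controlledTransform_eq_map_of_chart`, if the chart generator `c_i` itself lies in `K_s` then the
exponent-one controlled transform `σᶜ(K, 1)` (the weak transform; for a regular `V(K) ⊇ V(D)` the strict transform,
GW 13.96 (2)) is the unit ideal at `x'` — so a point ON `V(σᶜ(K, 1))` never lies in such a chart ([24] Lemma 10.3 proof,
p.116 l.9–12: the `y`-charts miss the strict transform of `W`). [cite: GortzWedhorn2020, Prop. 13.96 (2); StacksProject, Tag 0804] -/
theorem IsBlowup.stalkIdeal_controlledTransform_eq_top_of_chart_mem (hπ : IsBlowup π D) (x' : X') {k : ℕ}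
    (c : Fin k → X.presheaf.stalk (π x')) (hc : Ideal.span (Set.range c) = stalkIdeal D (π x')) (i : Fin k)
    (χ : blowupAlgebra (Ideal.span (Set.range c)) (c i) →+* X'.presheaf.stalk x')
    (hχ : ∀ a, χ (algebraMap _ _ a) = (π.stalkMap x').hom a)
    (hg : (π.stalkMap x').hom (c i) ∈ nonZeroDivisors (X'.presheaf.stalk x'))
    (K : X.IdealSheafData) (hKD : stalkIdeal K (π x') ≤ Ideal.span (Set.range c)) (hi : c i ∈ stalkIdeal K (π x')) :
    stalkIdeal (controlledTransform π D K 1) x' = ⊤ := by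
  obtain ⟨-, h⟩ := hπ.stalkIdeal_controlledTransform_eq_map_of_chart x' c hc i χ hχ hg
  rw [h K 1 (by rwa [pow_one]), Ideal.eq_top_iff_one, ← map_one χ]
  exact Ideal.mem_map_of_mem χ (Ideal.subset_span ⟨c i, hi, by rw [one_mul, pow_one]⟩)

set_option maxHeartbeats 800000 in -- as above
/-- **The same dictionary from a LOCALISATION presentation** (`IsLocalization.AtPrime 𝒪_{X',x'} 𝔔` along `χ`, as delivered by
`blowupAlgebra_stalk_ringEquiv_of_reesChart` / `IsBlowup.exists_blowupAlgebra_stalk_ringEquiv`): the non-zero-divisor hypothesis on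
`g = π^♯(c_i) = χ(c_i/1)` is automatic, `c_i/1` being a non-zero-divisor of `𝒪_{X,s}[I/c_i]` (Stacks 07Z3 (1)) and `χ` a localisation map.
[cite: StacksProject, Tag 0804; StacksProject, Tag 07Z3] -/
theorem IsBlowup.stalkIdeal_controlledTransform_eq_map_of_isLocalization (hπ : IsBlowup π D) (x' : X') {k : ℕ}
    (c : Fin k → X.presheaf.stalk (π x')) (hc : Ideal.span (Set.range c) = stalkIdeal D (π x')) (i : Fin k)
    (𝔔 : PrimeSpectrum (blowupAlgebra (Ideal.span (Set.range c)) (c i)))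
    (χ : blowupAlgebra (Ideal.span (Set.range c)) (c i) →+* X'.presheaf.stalk x')
    (hχ : ∀ a, χ (algebraMap _ _ a) = (π.stalkMap x').hom a)
    (hloc : @IsLocalization.AtPrime _ _ (X'.presheaf.stalk x') _ χ.toAlgebra 𝔔.asIdeal _) :
    stalkIdeal (D.comap π) x' = Ideal.span {(π.stalkMap x').hom (c i)} ∧
      ∀ (K : X.IdealSheafData) (a : ℕ), stalkIdeal K (π x') ≤ Ideal.span (Set.range c) ^ a →
        stalkIdeal (controlledTransform π D K a) x' =
          (Ideal.span {u : blowupAlgebra (Ideal.span (Set.range c)) (c i) |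
              ∃ g ∈ stalkIdeal K (π x'),
                u * algebraMap _ (blowupAlgebra (Ideal.span (Set.range c)) (c i)) (c i) ^ a =
                  algebraMap _ (blowupAlgebra (Ideal.span (Set.range c)) (c i)) g}).map χ := by
  refine hπ.stalkIdeal_controlledTransform_eq_map_of_chart x' c hc i χ hχ ?_
  letI := χ.toAlgebra
  haveI : IsLocalization.AtPrime (X'.presheaf.stalk x') 𝔔.asIdeal := hloc
  have h1 : algebraMap _ (X'.presheaf.stalk x') (algebraMap _ (blowupAlgebra (Ideal.span (Set.range c)) (c i)) (c i)) ∈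
      nonZeroDivisors (X'.presheaf.stalk x') :=
    IsLocalization.nonZeroDivisors_le_comap 𝔔.asIdeal.primeCompl (X'.presheaf.stalk x')
      algebraMap_mem_nonZeroDivisors_blowupAlgebra
  rw [RingHom.algebraMap_toAlgebra, hχ] at h1
  exact h1

end ControlledTransform

end Literature.AlgebraicGeometry.Resolution

end
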